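import Mathlib

/-!
# The factorisation constraint of the level-one template calculus (block template inequality)

Crux `Summit.MatrixMultiplication.MatrixMultiplication.Theses.SnSubsetDichotomy.PolynomialSlack`
(item `stmt-MatrixMultiplication-8306`), level-one programme, lead c5. The level-one statistic of a TPP
triple is a trilinear form in the pair marginals `m_{ST}, m_{TU}, m_{US}` of the three quotient sets
`S⁻¹T, T⁻¹U, U⁻¹S`; its negative ("pinning") part is produced by TEMPLATES: blocks of positions
`X ⊆ pos(T)`, `Y ⊆ pos(U)` (the hub), `Z ⊆ pos(S)` on which `T⁻¹U` and `U⁻¹S` have excess mass and `S⁻¹T`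
has a deficit. What distinguishes quotient triples from general product-free triples (Gowers/Kedlaya) at
level one is the following pointwise constraint: for all permutations `s, t, u`,
`|u(Y) ∩ t(X)| + |u(Y) ∩ s(Z)| ≤ |Y| + |t(X) ∩ s(Z)|` (inclusion–exclusion inside `u(Y)`), i.e. the two
excess counts of a template cannot both be large unless the deficit block is NOT empty. Summed over the
triple:

* `blockTemplate_pointwise` — the pointwise inequality, written with the tree's marginal indicators;
* `blockTemplate_le` — `(Σ_{j∈X,k∈Y} m_{TU}(j,k))·|S| + (Σ_{k∈Y,i∈Z} m_{US}(k,i))·|T|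
   ≤ |Y|·|S||T||U| + (Σ_{i∈Z,j∈X} m_{ST}(i,j))·|U|`
  (`m_{TU}(j,k) = #{(t,u) : u k = t j}`, `m_{US}(k,i) = #{(u,s) : s i = u k}`, `m_{ST}(i,j) = #{(s,t) : t j = s i}`,
  the tree's conventions). The case `|Y| = 1`, empty deficit block, is `no_kedlaya_quotient_triple`.
-/

namespace Summit.MatrixMultiplication.MatrixMultiplication.Theorems.PolynomialSlack

open scoped BigOperators
open Finset

set_option linter.dupNamespace false

/-- **Block template inequality, pointwise.** For permutations `s, t, u` of `Fin n` and position blocks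
`X, Y, Z`: `#{(j,k) ∈ X×Y : u k = t j} + #{(k,i) ∈ Y×Z : s i = u k} ≤ |Y| + #{(i,j) ∈ Z×X : t j = s i}`,
i.e. `|u(Y) ∩ t(X)| + |u(Y) ∩ s(Z)| ≤ |Y| + |t(X) ∩ s(Z)|` (inclusion–exclusion inside `u(Y)`, then the
injection `k ↦ (s⁻¹(u k), t⁻¹(u k))`). [folklore] -/
theorem blockTemplate_pointwise {n : ℕ} (s t u : Equiv.Perm (Fin n)) (X Y Z : Finset (Fin n)) :
    ((X ×ˢ Y).filter fun p => u p.2 = t p.1).card + ((Y ×ˢ Z).filter fun p => s p.2 = u p.1).card ≤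
      Y.card + ((Z ×ˢ X).filter fun p => t p.2 = s p.1).card := by
  classical
  -- the hub positions hit by the first, resp. second, block
  set I₁ : Finset (Fin n) := Y.filter fun k => ∃ j ∈ X, u k = t j with hI₁
  set I₂ : Finset (Fin n) := Y.filter fun k => ∃ i ∈ Z, s i = u k with hI₂
  have h1 : ((X ×ˢ Y).filter fun p => u p.2 = t p.1).card ≤ I₁.card := by
    refine Finset.card_le_card_of_injOn (fun p => p.2) (fun p hp => ?_) (fun p hp q hq hpq => ?_)
    · simp only [Finset.coe_filter, Finset.mem_product, Set.mem_setOf_eq] at hp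
      simp only [hI₁, Finset.coe_filter, Set.mem_setOf_eq]
      exact ⟨hp.1.2, p.1, hp.1.1, hp.2⟩
    · simp only [Finset.coe_filter, Finset.mem_product, Set.mem_setOf_eq] at hp hq
      have h2 : p.2 = q.2 := hpq
      have h1 : p.1 = q.1 := t.injective (by rw [← hp.2, ← hq.2, h2])
      exact Prod.ext h1 h2
  have h2 : ((Y ×ˢ Z).filter fun p => s p.2 = u p.1).card ≤ I₂.card := by
    refine Finset.card_le_card_of_injOn (fun p => p.1) (fun p hp => ?_) (fun p hp q hq hpq => ?_)
    · simp only [Finset.coe_filter, Finset.mem_product, Set.mem_setOf_eq] at hp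
      simp only [hI₂, Finset.coe_filter, Set.mem_setOf_eq]
      exact ⟨hp.1.1, p.2, hp.1.2, hp.2⟩
    · simp only [Finset.coe_filter, Finset.mem_product, Set.mem_setOf_eq] at hp hq
      have h1 : p.1 = q.1 := hpq
      have h2 : p.2 = q.2 := s.injective (by rw [hp.2, hq.2, h1])
      exact Prod.ext h1 h2
  -- inclusion–exclusion inside `Y`
  have hIE : I₁.card + I₂.card ≤ Y.card + (I₁ ∩ I₂).card := by
    rw [← Finset.card_union_add_card_inter]
    have : (I₁ ∪ I₂).card ≤ Y.card :=
      Finset.card_le_card (Finset.union_subset (Finset.filter_subset _ _) (Finset.filter_subset _ _))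
    omega
  -- the doubly hit hub positions inject into the pairs of the deficit block
  have h3 : (I₁ ∩ I₂).card ≤ ((Z ×ˢ X).filter fun p => t p.2 = s p.1).card := by
    refine Finset.card_le_card_of_injOn (fun k => (s⁻¹ (u k), t⁻¹ (u k))) (fun k hk => ?_)
      (fun k _ k' _ hkk => ?_)
    · have hk' : k ∈ I₁ ∧ k ∈ I₂ := Finset.mem_inter.1 hk
      have hk1 : ∃ j ∈ X, u k = t j := by
        have := hk'.1; rw [hI₁, Finset.mem_filter] at this; exact this.2
      have hk2 : ∃ i ∈ Z, s i = u k := by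
        have := hk'.2; rw [hI₂, Finset.mem_filter] at this; exact this.2
      obtain ⟨j, hj, hjk⟩ := hk1
      obtain ⟨i, hi, hik⟩ := hk2
      have ei : s⁻¹ (u k) = i := by rw [← hik]; exact Equiv.Perm.inv_eq_iff_eq.2 rfl
      have ej : t⁻¹ (u k) = j := by rw [hjk]; exact Equiv.Perm.inv_eq_iff_eq.2 rfl
      simp only [Finset.coe_filter, Finset.mem_product, Set.mem_setOf_eq, ei, ej]
      exact ⟨⟨hi, hj⟩, by rw [← hjk, hik]⟩
    · have h1 : s⁻¹ (u k) = s⁻¹ (u k') := (Prod.mk.inj hkk).1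
      exact u.injective (s⁻¹.injective h1)
  omega

/-- Double counting: a block sum of pair marginals is the sum, over the pairs, of the number of block
cells they realise. [folklore] -/
theorem blockSum_pairMarginal_eq {n : ℕ} (A B : Finset (Equiv.Perm (Fin n))) (X Y : Finset (Fin n)) :
    (∑ j ∈ X, ∑ k ∈ Y, ((A ×ˢ B).filter fun ab => ab.2 k = ab.1 j).card) =
      ∑ q ∈ A ×ˢ B, ((X ×ˢ Y).filter fun p => q.2 p.2 = q.1 p.1).card := by
  rw [← Finset.sum_product' (f := fun j k => ((A ×ˢ B).filter fun ab => ab.2 k = ab.1 j).card)]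
  simp only [Finset.card_filter]
  exact Finset.sum_comm

/-- **Block template inequality (the factorisation constraint).** For all finite `S, T, U ⊆ S_n` and position
blocks `X, Y, Z`:
`(Σ_{j∈X} Σ_{k∈Y} m_{TU}(j,k))·|S| + (Σ_{k∈Y} Σ_{i∈Z} m_{US}(k,i))·|T| ≤ |Y|·(|S||T||U|) + (Σ_{i∈Z} Σ_{j∈X} m_{ST}(i,j))·|U|`,
with the pair marginals `m_{TU}(j,k) = #{(t,u) ∈ T×U : u k = t j}`, `m_{US}(k,i) = #{(u,s) ∈ U×S : s i = u k}`,
`m_{ST}(i,j) = #{(s,t) ∈ S×T : t j = s i}` (tree conventions). In the template calculus of the level-one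
equation this is `μ_B + μ_C ≤ |Y| + ω`. [folklore] -/
theorem blockTemplate_le {n : ℕ} (S T U : Finset (Equiv.Perm (Fin n))) (X Y Z : Finset (Fin n)) :
    (∑ j ∈ X, ∑ k ∈ Y, ((T ×ˢ U).filter fun tu => tu.2 k = tu.1 j).card) * S.card +
        (∑ k ∈ Y, ∑ i ∈ Z, ((U ×ˢ S).filter fun us => us.2 i = us.1 k).card) * T.card ≤
      Y.card * (S.card * T.card * U.card) +
        (∑ i ∈ Z, ∑ j ∈ X, ((S ×ˢ T).filter fun st => st.2 j = st.1 i).card) * U.card := by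
  -- the three block counts realised by one triple `x = (s, (t, u))`
  set g₁ : Equiv.Perm (Fin n) × Equiv.Perm (Fin n) → ℕ :=
    fun q => ((X ×ˢ Y).filter fun p => q.2 p.2 = q.1 p.1).card with hg₁
  set g₂ : Equiv.Perm (Fin n) × Equiv.Perm (Fin n) → ℕ :=
    fun r => ((Y ×ˢ Z).filter fun p => r.2 p.2 = r.1 p.1).card with hg₂
  set g₃ : Equiv.Perm (Fin n) × Equiv.Perm (Fin n) → ℕ :=
    fun w => ((Z ×ˢ X).filter fun p => w.2 p.2 = w.1 p.1).card with hg₃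
  rw [blockSum_pairMarginal_eq T U X Y, blockSum_pairMarginal_eq U S Y Z,
    blockSum_pairMarginal_eq S T Z X]
  change (∑ q ∈ T ×ˢ U, g₁ q) * S.card + (∑ r ∈ U ×ˢ S, g₂ r) * T.card ≤
    Y.card * (S.card * T.card * U.card) + (∑ w ∈ S ×ˢ T, g₃ w) * U.card
  -- rewrite the four terms as iterated sums `∑ s ∈ S, ∑ t ∈ T, ∑ u ∈ U`
  have e1 : (∑ q ∈ T ×ˢ U, g₁ q) * S.card = ∑ s ∈ S, ∑ t ∈ T, ∑ u ∈ U, g₁ (t, u) := by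
    rw [Finset.sum_const, smul_eq_mul, mul_comm, Finset.sum_product]
  have e2 : (∑ r ∈ U ×ˢ S, g₂ r) * T.card = ∑ s ∈ S, ∑ t ∈ T, ∑ u ∈ U, g₂ (u, s) := by
    rw [Finset.sum_product, Finset.sum_comm, Finset.sum_mul]
    refine Finset.sum_congr rfl fun s _ => ?_
    rw [Finset.sum_comm, Finset.sum_mul]
    refine Finset.sum_congr rfl fun u _ => ?_
    rw [Finset.sum_const, smul_eq_mul, mul_comm]
  have e3 : (∑ w ∈ S ×ˢ T, g₃ w) * U.card = ∑ s ∈ S, ∑ t ∈ T, ∑ u ∈ U, g₃ (s, t) := by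
    rw [Finset.sum_product, Finset.sum_mul]
    refine Finset.sum_congr rfl fun s _ => ?_
    rw [Finset.sum_mul]
    refine Finset.sum_congr rfl fun t _ => ?_
    rw [Finset.sum_const, smul_eq_mul, mul_comm]
  have e4 : Y.card * (S.card * T.card * U.card) = ∑ s ∈ S, ∑ t ∈ T, ∑ u ∈ U, Y.card := by
    simp only [Finset.sum_const, smul_eq_mul]
    ring
  rw [e1, e2, e3, e4, ← Finset.sum_add_distrib, ← Finset.sum_add_distrib]
  refine Finset.sum_le_sum fun s _ => ?_
  rw [← Finset.sum_add_distrib, ← Finset.sum_add_distrib]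
  refine Finset.sum_le_sum fun t _ => ?_
  rw [← Finset.sum_add_distrib, ← Finset.sum_add_distrib]
  refine Finset.sum_le_sum fun u _ => ?_
  exact blockTemplate_pointwise s t u X Y Z

end Summit.MatrixMultiplication.MatrixMultiplication.Theorems.PolynomialSlack
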